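import Summits.Schanuel.Schanuel.Theorems.ZilberEacBottomEdgePoints
import Summits.Schanuel.Schanuel.Theorems.ZilberEacRelationPuiseux
import HarnessLib

/-!
# The exponential-polynomial regime, CXVIII: THE GUARD ALONG A DEGENERATE DIRECTION and the
# bottom-edge engine WITH A GUARD

HONEST FRAMING.  Cell `pub-schanuel` (Zilber's Exponential-Algebraic Closedness, case ladder;
host summit Schanuel), seat 2, gen 35.  Towards the `∀ W` theorem of Mantova–Masser's
exponential-polynomial regime (O92 (a)): the minimal fibre polynomial `P ∈ ℂ[x₀, x₁, y₁][y₀]`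
of a surface `W` divides the ideal of `W` only after multiplication by a power of its top
coefficient `c = lc(P) ∈ ℂ[x₀, x₁, y₁]`, so membership of a point of
`{F = 0, P(x, e^{x₁}; y₀) = 0}` in `W` needs the GUARD `c(x, e^{x₁}) ≠ 0`.  Along a place
`x₀ = s^{-k}`, `x₁ = Φ(s)s^{-M}` (`M ≥ 1`) the guard can FAIL on a sequence `s → 0` (e.g.
`c = y₁ − 1`), but it holds eventually in every degenerate direction `Re x₁ ≤ −c₀|s|^{-M}`
(`c₀ > 0`): there `y₁ = e^{x₁}` is super-exponentially small, and with `c = Σ_j c_j(x) y₁^j`,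
`j₀` the least index with `F ∤ c_{j₀}`, the term `c_{j₀}(x(s)) y₁^{j₀} = ψ(s)s^L y₁^{j₀}`
(`ψ(0) ≠ 0`) dominates: **`eventually_guard_ne_zero`**.  Consequently the engine of file CXV (b)
holds with the membership hypothesis weakened by the guard:
**`unprojectedDense_bottomEdge_guard`**.  Mantova–Masser's question (PLMS 2024 §1 p. 5) stays
OPEN; EC(3,2) OPEN; NOT Schanuel's conjecture (neither used nor implied); EAC ⇏ SC.
-/

noncomputable section

open Filter Topology Metric Complex Polynomial
open Literature.NumberTheory.Transcendental Literature.ModelTheory.Zilber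
open Literature.ModelTheory.ExponentialFields

set_option linter.dupNamespace false

namespace Summit.Schanuel.Schanuel.Theorems

section DegenerateDirectionGuard

variable (F : ℂ[X][X])

/-! ## Part A. The guard along a degenerate direction -/

/-- **THE GUARD LEMMA.**  `F` irreducible of positive `x₁`-degree; a place `x₀ = s^{-k}`,
`x₁ = Φ(s)s^{-M}` (`k, M ≥ 1`); `F₃` = `F` inside `ℂ[x₀, x₁, y₁]` (through its values);
`c ∈ ℂ[x₀, x₁, y₁]` not divisible by `F₃`; `c₀ > 0`.  Then for all small `s ≠ 0` in the
degenerate region `Re x₁(s) ≤ −c₀|s|^{-M}` the guard `c(x₀(s), x₁(s), e^{x₁(s)}) ≠ 0` holds.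
[folklore] (new) -/
theorem eventually_guard_ne_zero (hFirr : Irreducible F) (hn : 1 ≤ F.natDegree)
    {k : ℕ} (hk : 1 ≤ k) {M : ℕ} (hM : 1 ≤ M) {Φ : ℂ → ℂ} (hΦan : AnalyticAt ℂ Φ 0)
    (hplace : ∀ᶠ s in 𝓝[≠] (0 : ℂ),
      (F.map (Polynomial.evalRingHom (s ^ k)⁻¹)).eval (Φ s * (s ^ M)⁻¹) = 0)
    (F₃ : MvPolynomial (Fin 3) ℂ)
    (hF₃ : ∀ v : Fin 3 → ℂ, MvPolynomial.eval v F₃ = (F.map (Polynomial.evalRingHom (v 0))).eval (v 1))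
    (c : MvPolynomial (Fin 3) ℂ) (hc : ¬ F₃ ∣ c) {c₀ : ℝ} (hc₀ : 0 < c₀) :
    ∀ᶠ s in 𝓝[≠] (0 : ℂ), (Φ s * (s ^ M)⁻¹).re ≤ -c₀ * ‖s‖⁻¹ ^ M →
      MvPolynomial.eval ![(s ^ k)⁻¹, Φ s * (s ^ M)⁻¹, Complex.exp (Φ s * (s ^ M)⁻¹)] c ≠ 0 := by
  classical
  obtain ⟨κ, hκ⟩ := exists_rowsEquiv₃
  -- `κ⁻¹ (C F) = F₃` (same values)
  have hκF : κ.symm (Polynomial.C F) = F₃ := by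
    refine MvPolynomial.funext fun v => ?_
    have e : v = ![v 0, v 1, v 2] := by funext i; fin_cases i <;> rfl
    rw [hF₃, e, hκ, RingEquiv.apply_symm_apply, Polynomial.map_C, Polynomial.eval_C,
      Polynomial.coe_eval₂RingHom, Polynomial.eval₂_eq_eval_map]
    rfl
  -- some `y₁`-coefficient of `κ c` is not divisible by `F`
  have hex' : ∃ m, ¬ F ∣ (κ c).coeff m := by
    by_contra hall
    push Not at hall
    obtain ⟨Q, hQ⟩ := (Polynomial.C_dvd_iff_dvd_coeff F (κ c)).2 hall
    apply hc
    refine ⟨κ.symm Q, ?_⟩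
    apply κ.injective
    rw [map_mul, RingEquiv.apply_symm_apply, ← hκF, RingEquiv.apply_symm_apply]
    exact hQ
  -- the `y₁`-expansion `Q` of `c`, made opaque
  obtain ⟨Q, hκQ, hex⟩ : ∃ Q : Polynomial ℂ[X][X], (∀ a b e : ℂ, MvPolynomial.eval ![a, b, e] c =
      (Q.map (Polynomial.eval₂RingHom (Polynomial.evalRingHom a) b)).eval e) ∧
      ∃ m, ¬ F ∣ Q.coeff m := ⟨κ c, fun a b e => hκ c a b e, hex'⟩
  obtain ⟨d, hd⟩ : ∃ d : ℕ, Q.natDegree = d := ⟨_, rfl⟩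
  -- the least index `j₀` with `F ∤ Q_{j₀}`
  obtain ⟨j₀, hj₀, hbelow⟩ : ∃ j₀, ¬ F ∣ Q.coeff j₀ ∧ ∀ j, j < j₀ → F ∣ Q.coeff j := by
    refine ⟨Nat.find hex, Nat.find_spec hex, fun j hj => ?_⟩
    have h := Nat.find_min hex hj
    push Not at h
    exact h
  have hj₀d : j₀ ≤ d := by
    by_contra h
    exact hj₀ (by rw [Polynomial.coeff_eq_zero_of_natDegree_lt (by omega)]; exact dvd_zero F)
  have hj₀mem : j₀ ∈ Finset.range (d + 1) := Finset.mem_range.2 (by omega)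
  -- rows along the place
  have hrow := exists_row_along_place F hFirr hn hk M hΦan hplace
  choose ψ L hψan hψ0 hψev using fun m => hrow (Q.coeff m)
  have hψ00 : ψ j₀ 0 ≠ 0 := hψ0 j₀ hj₀
  have hψpos : 0 < ‖ψ j₀ 0‖ / 2 := half_pos (norm_pos_iff.2 hψ00)
  -- a uniform exponent and a uniform constant for the rows `m ≤ d`
  obtain ⟨N, hLN⟩ : ∃ N : ℕ, ∀ m ∈ Finset.range (d + 1), -(N : ℤ) ≤ L m ∧ L m ≤ N := by
    refine ⟨(Finset.range (d + 1)).sup fun m => (L m).natAbs, fun m hm => ?_⟩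
    have h1 : (L m).natAbs ≤ (Finset.range (d + 1)).sup fun m => (L m).natAbs :=
      Finset.le_sup (f := fun m => (L m).natAbs) hm
    constructor <;> omega
  obtain ⟨A, hA0, hAm⟩ : ∃ A : ℝ, 0 < A ∧ ∀ m ∈ Finset.range (d + 1), ‖ψ m 0‖ + 1 ≤ A := by
    refine ⟨∑ m ∈ Finset.range (d + 1), (‖ψ m 0‖ + 1), ?_, fun m hm =>
      Finset.single_le_sum (f := fun m => ‖ψ m 0‖ + 1) (fun i _ => by positivity) hm⟩
    exact lt_of_lt_of_le (by positivity) (Finset.single_le_sum (f := fun m => ‖ψ m 0‖ + 1)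
      (fun i _ => by positivity) hj₀mem)
  obtain ⟨ε₀, hε₀pos, hε₀⟩ : ∃ ε₀ : ℝ, 0 < ε₀ ∧ (d : ℝ) * A * ε₀ < ‖ψ j₀ 0‖ / 2 := by
    refine ⟨‖ψ j₀ 0‖ / 2 / ((d : ℝ) * A + 1), by positivity, ?_⟩
    rw [show (d : ℝ) * A * (‖ψ j₀ 0‖ / 2 / ((d : ℝ) * A + 1)) =
      ‖ψ j₀ 0‖ / 2 * ((d : ℝ) * A / ((d : ℝ) * A + 1)) by ring]
    have hlt : (d : ℝ) * A / ((d : ℝ) * A + 1) < 1 := by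
      rw [div_lt_one (by positivity)]
      linarith
    calc ‖ψ j₀ 0‖ / 2 * ((d : ℝ) * A / ((d : ℝ) * A + 1)) < ‖ψ j₀ 0‖ / 2 * 1 :=
          mul_lt_mul_of_pos_left hlt hψpos
      _ = ‖ψ j₀ 0‖ / 2 := mul_one _
  -- eventual facts along the place
  have hall : ∀ᶠ s in 𝓝[≠] (0 : ℂ), ∀ m ∈ Finset.range (d + 1),
      ((Q.coeff m).map (Polynomial.evalRingHom (s ^ k)⁻¹)).eval (Φ s * (s ^ M)⁻¹) =
          ψ m s * s ^ L m ∧ ‖ψ m s‖ ≤ ‖ψ m 0‖ + 1 := by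
    refine (Finset.eventually_all _).2 fun m _ => (hψev m).and ?_
    have h1 : Tendsto (ψ m) (𝓝[≠] 0) (𝓝 (ψ m 0)) :=
      (hψan m).continuousAt.tendsto.mono_left nhdsWithin_le_nhds
    filter_upwards [(Metric.tendsto_nhds.1 h1) 1 one_pos] with s hs
    rw [dist_eq_norm] at hs
    linarith [norm_le_norm_add_norm_sub' (ψ m s) (ψ m 0)]
  have hψhalf : ∀ᶠ s in 𝓝[≠] (0 : ℂ), ‖ψ j₀ 0‖ / 2 ≤ ‖ψ j₀ s‖ := by
    have h1 : Tendsto (ψ j₀) (𝓝[≠] 0) (𝓝 (ψ j₀ 0)) :=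
      (hψan j₀).continuousAt.tendsto.mono_left nhdsWithin_le_nhds
    filter_upwards [(Metric.tendsto_nhds.1 h1) _ hψpos] with s hs
    rw [dist_eq_norm] at hs
    linarith [norm_sub_norm_le (ψ j₀ 0) (ψ j₀ s), norm_sub_rev (ψ j₀ 0) (ψ j₀ s)]
  have hsmall1 : ∀ᶠ s in 𝓝[≠] (0 : ℂ), ‖s‖ < 1 := by
    have h : Tendsto (fun s : ℂ => s) (𝓝[≠] 0) (𝓝 0) := tendsto_id.mono_left nhdsWithin_le_nhds
    filter_upwards [(Metric.tendsto_nhds.1 h) 1 one_pos] with s hs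
    rwa [dist_zero_right] at hs
  -- the decisive inequality `t^{-2N} e^{-c₀ t^{-M}} < ε₀`, `t = |s|`
  have hdec : ∀ᶠ s in 𝓝[≠] (0 : ℂ),
      ‖s‖ ^ (-((N + N : ℕ) : ℤ)) * Real.exp (-(c₀ * ‖s‖ ^ (-(M : ℤ)))) < ε₀ := by
    have h := (tendsto_zpow_neg_mul_exp_neg hc₀ hM (N + N)).comp
      (tendsto_norm_nhdsNE_zero (E := ℂ))
    exact h.eventually (gt_mem_nhds hε₀pos)
  filter_upwards [hall, hψhalf, hsmall1, hdec, hplace, self_mem_nhdsWithin]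
    with s hrows hhalf hs1 hdecs hFs hs0 hre
  replace hs0 : s ≠ 0 := hs0
  have hsn : 0 < ‖s‖ := norm_pos_iff.2 hs0
  have hzp : ∀ n : ℤ, 0 < ‖s‖ ^ n := fun n => zpow_pos hsn n
  -- the size of `y₁ = e^{x₁}`
  set y₁ : ℂ := Complex.exp (Φ s * (s ^ M)⁻¹) with hy₁
  have hy1 : ‖y₁‖ ≤ Real.exp (-(c₀ * ‖s‖ ^ (-(M : ℤ)))) := by
    rw [hy₁, Complex.norm_exp]
    refine Real.exp_le_exp.2 ?_
    have e : ‖s‖ ^ (-(M : ℤ)) = ‖s‖⁻¹ ^ M := by rw [zpow_neg, zpow_natCast, inv_pow]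
    rw [e]
    linarith
  have hy11 : ‖y₁‖ ≤ 1 := hy1.trans (by
    rw [Real.exp_le_one_iff]
    have : 0 ≤ c₀ * ‖s‖ ^ (-(M : ℤ)) := mul_nonneg hc₀.le (hzp _).le
    linarith)
  have hy10 : y₁ ≠ 0 := Complex.exp_ne_zero _
  have hy1n : 0 < ‖y₁‖ := norm_pos_iff.2 hy10
  have hyp : ∀ n : ℕ, 0 < ‖y₁‖ ^ n := fun n => pow_pos hy1n n
  -- expand `c` along its `y₁`-rows
  have hf : ∀ m, (Polynomial.eval₂RingHom (Polynomial.evalRingHom (s ^ k)⁻¹) (Φ s * (s ^ M)⁻¹))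
      (Q.coeff m) = ((Q.coeff m).map (Polynomial.evalRingHom (s ^ k)⁻¹)).eval (Φ s * (s ^ M)⁻¹) :=
    fun m => by rw [Polynomial.coe_eval₂RingHom, Polynomial.eval₂_eq_eval_map]
  rw [hκQ, eval_map_eq_rowSum Q _ hd.le, ← Finset.add_sum_erase _ _ hj₀mem]
  -- the bound for every term other than `j₀`
  set B : ℝ := A * ‖s‖ ^ (-(N : ℤ)) * ‖y₁‖ ^ (j₀ + 1) with hB
  have hB0 : 0 ≤ B := (mul_pos (mul_pos hA0 (hzp _)) (hyp _)).le
  have hterm : ∀ m ∈ (Finset.range (d + 1)).erase j₀,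
      ‖(Polynomial.eval₂RingHom (Polynomial.evalRingHom (s ^ k)⁻¹) (Φ s * (s ^ M)⁻¹))
          (Q.coeff m) * y₁ ^ m‖ ≤ B := by
    intro m hm
    obtain ⟨hmj, hmr⟩ := Finset.mem_erase.1 hm
    rcases lt_or_gt_of_ne hmj with hlt | hgt
    · -- `m < j₀`: the row vanishes on the curve
      obtain ⟨H, hH⟩ := hbelow m hlt
      rw [hf, hH, Polynomial.map_mul, Polynomial.eval_mul, hFs, zero_mul, zero_mul, norm_zero]
      exact hB0
    · -- `m > j₀`: polynomial size of the row, `|y₁|^m ≤ |y₁|^{j₀+1}`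
      obtain ⟨hrow, hψb⟩ := hrows m hmr
      rw [hf, hrow, norm_mul, norm_mul, norm_zpow, norm_pow, hB]
      have h1 : ‖ψ m s‖ ≤ A := hψb.trans (hAm m hmr)
      have h2 : ‖s‖ ^ L m ≤ ‖s‖ ^ (-(N : ℤ)) :=
        zpow_le_zpow_right_of_le_one₀ hsn hs1.le (hLN m hmr).1
      have h3 : ‖y₁‖ ^ m ≤ ‖y₁‖ ^ (j₀ + 1) := pow_le_pow_of_le_one hy1n.le hy11 (by omega)
      exact mul_le_mul (mul_le_mul h1 h2 (hzp _).le hA0.le) h3 (hyp _).le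
        (mul_pos hA0 (hzp _)).le
  have hrest : ‖∑ m ∈ (Finset.range (d + 1)).erase j₀,
      (Polynomial.eval₂RingHom (Polynomial.evalRingHom (s ^ k)⁻¹) (Φ s * (s ^ M)⁻¹))
        (Q.coeff m) * y₁ ^ m‖ ≤ d * B := by
    refine (norm_sum_le _ _).trans ?_
    have h := Finset.sum_le_card_nsmul _ _ B hterm
    rw [Finset.card_erase_of_mem hj₀mem, Finset.card_range, Nat.add_sub_cancel, nsmul_eq_mul] at h
    exact h
  -- the main term
  obtain ⟨hrow₀, -⟩ := hrows j₀ hj₀mem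
  have hmain : ‖ψ j₀ 0‖ / 2 * ‖s‖ ^ (N : ℤ) * ‖y₁‖ ^ j₀ ≤
      ‖(Polynomial.eval₂RingHom (Polynomial.evalRingHom (s ^ k)⁻¹) (Φ s * (s ^ M)⁻¹))
          (Q.coeff j₀) * y₁ ^ j₀‖ := by
    rw [hf, hrow₀, norm_mul, norm_mul, norm_zpow, norm_pow]
    have h2 : ‖s‖ ^ (N : ℤ) ≤ ‖s‖ ^ L j₀ :=
      zpow_le_zpow_right_of_le_one₀ hsn hs1.le (hLN j₀ hj₀mem).2
    exact mul_le_mul_of_nonneg_right (mul_le_mul hhalf h2 (hzp _).le (norm_nonneg _)) (hyp _).le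
  -- comparison: `d·B < (|ψ(0)|/2)|s|^N |y₁|^{j₀}`
  have hcmp : (d : ℝ) * B < ‖ψ j₀ 0‖ / 2 * ‖s‖ ^ (N : ℤ) * ‖y₁‖ ^ j₀ := by
    -- `|s|^{-N} |y₁| ≤ ε₀ |s|^N`
    have e1 : ‖s‖ ^ (-(N : ℤ)) = ‖s‖ ^ (-((N + N : ℕ) : ℤ)) * ‖s‖ ^ (N : ℤ) := by
      rw [← zpow_add₀ hsn.ne']
      congr 1
      push_cast
      ring
    have h1 : ‖s‖ ^ (-(N : ℤ)) * ‖y₁‖ ≤ ε₀ * ‖s‖ ^ (N : ℤ) := by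
      rw [e1]
      calc ‖s‖ ^ (-((N + N : ℕ) : ℤ)) * ‖s‖ ^ (N : ℤ) * ‖y₁‖
          = ‖s‖ ^ (-((N + N : ℕ) : ℤ)) * ‖y₁‖ * ‖s‖ ^ (N : ℤ) := by ring
        _ ≤ ‖s‖ ^ (-((N + N : ℕ) : ℤ)) * Real.exp (-(c₀ * ‖s‖ ^ (-(M : ℤ)))) * ‖s‖ ^ (N : ℤ) :=
            mul_le_mul_of_nonneg_right (mul_le_mul_of_nonneg_left hy1 (hzp _).le) (hzp _).le
        _ ≤ ε₀ * ‖s‖ ^ (N : ℤ) := mul_le_mul_of_nonneg_right hdecs.le (hzp _).le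
    have hdA : 0 ≤ (d : ℝ) * A := mul_nonneg (Nat.cast_nonneg _) hA0.le
    have h2 : (d : ℝ) * B ≤ (d : ℝ) * A * ε₀ * (‖s‖ ^ (N : ℤ) * ‖y₁‖ ^ j₀) := by
      rw [hB, pow_succ]
      calc (d : ℝ) * (A * ‖s‖ ^ (-(N : ℤ)) * (‖y₁‖ ^ j₀ * ‖y₁‖))
          = (d : ℝ) * A * (‖s‖ ^ (-(N : ℤ)) * ‖y₁‖) * ‖y₁‖ ^ j₀ := by ring
        _ ≤ (d : ℝ) * A * (ε₀ * ‖s‖ ^ (N : ℤ)) * ‖y₁‖ ^ j₀ :=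
            mul_le_mul_of_nonneg_right (mul_le_mul_of_nonneg_left h1 hdA) (hyp _).le
        _ = _ := by ring
    have hpos : 0 < ‖s‖ ^ (N : ℤ) * ‖y₁‖ ^ j₀ := mul_pos (hzp _) (hyp _)
    calc (d : ℝ) * B ≤ (d : ℝ) * A * ε₀ * (‖s‖ ^ (N : ℤ) * ‖y₁‖ ^ j₀) := h2
      _ < ‖ψ j₀ 0‖ / 2 * (‖s‖ ^ (N : ℤ) * ‖y₁‖ ^ j₀) := mul_lt_mul_of_pos_right hε₀ hpos
      _ = _ := by ring
  -- conclusion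
  intro hsum
  have heq := eq_neg_of_add_eq_zero_left hsum
  have hlt : ‖∑ m ∈ (Finset.range (d + 1)).erase j₀,
      (Polynomial.eval₂RingHom (Polynomial.evalRingHom (s ^ k)⁻¹) (Φ s * (s ^ M)⁻¹))
        (Q.coeff m) * y₁ ^ m‖ <
      ‖(Polynomial.eval₂RingHom (Polynomial.evalRingHom (s ^ k)⁻¹) (Φ s * (s ^ M)⁻¹))
          (Q.coeff j₀) * y₁ ^ j₀‖ :=
    lt_of_le_of_lt hrest (lt_of_lt_of_le hcmp hmain)
  rw [heq, norm_neg] at hlt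
  exact lt_irrefl _ hlt

/-! ## Part B. The bottom-edge engine with a guard -/

/-- **DENSITY FROM A BOTTOM EDGE, WITH A GUARD (S-form).**  As `unprojectedDense_bottomEdge`
(file CXV (b)) — `F` irreducible of positive `x₁`-degree, place `x₀ = s^{-k}`,
`x₁ = Φ(s)s^{-M}` (`k, M ≥ 1`), `z^k = 2πi`, `Re(Φ(0)z^M) < 0`, `G ∈ ℂ[x₀, x₁, y₁][y₀]` whose
degenerate part `G₀ ≡ G(x, 0; y₀)` on the curve has two coefficients not divisible by `F` — but
the irreducible closed `S` (`dim S ≤ 2`) is only required to contain the points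
`(s^{-k}, Φ(s)s^{-M}, y, e^{Φ(s)s^{-M}})` with `y ≠ 0`, `G(x(s), e^{x₁(s)}; y) = 0` AND
`c(x(s), e^{x₁(s)}) ≠ 0`, for a guard `c ∈ ℂ[x₀, x₁, y₁]` not divisible by `F₃` (= `F`).
Conclusion: `S` has Zariski-dense exponential points.
[cite: MantovaMasser2023, §1 Further remarks, p. 5 (the question, open in general)] (new) -/
theorem unprojectedDense_bottomEdge_guard (hFirr : Irreducible F) (hn : 1 ≤ F.natDegree)
    {k : ℕ} (hk : 1 ≤ k) {M : ℕ} (hM : 1 ≤ M) {Φ : ℂ → ℂ} (hΦan : AnalyticAt ℂ Φ 0)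
    (hplace : ∀ᶠ s in 𝓝[≠] (0 : ℂ),
      (F.map (Polynomial.evalRingHom (s ^ k)⁻¹)).eval (Φ s * (s ^ M)⁻¹) = 0)
    {z : ℂ} (hz : z ^ k = 2 * Real.pi * I) (hdir : (Φ 0 * z ^ M).re < 0)
    (G : Polynomial (MvPolynomial (Fin 3) ℂ)) (G₀ : Polynomial ℂ[X][X])
    (hG₀ : ∀ x₀ x₁ y : ℂ, (F.map (Polynomial.evalRingHom x₀)).eval x₁ = 0 →
      (G₀.map (Polynomial.eval₂RingHom (Polynomial.evalRingHom x₀) x₁)).eval y =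
        (G.map (MvPolynomial.eval ![x₀, x₁, 0])).eval y)
    (h2 : ∃ i j, i < j ∧ ¬ F ∣ G₀.coeff i ∧ ¬ F ∣ G₀.coeff j)
    (F₃ : MvPolynomial (Fin 3) ℂ)
    (hF₃ : ∀ v : Fin 3 → ℂ, MvPolynomial.eval v F₃ = (F.map (Polynomial.evalRingHom (v 0))).eval (v 1))
    (c : MvPolynomial (Fin 3) ℂ) (hc : ¬ F₃ ∣ c)
    {S : Set (Fin 2 ⊕ Fin 2 → ℂ)} (hS : IsIrreducibleClosed ℂ S) (hdim : zariskiDim ℂ S ≤ (2 : ℕ))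
    (hsub : ∀ᶠ s in 𝓝[≠] (0 : ℂ), ∀ y : ℂ, y ≠ 0 →
      MvPolynomial.eval ![(s ^ k)⁻¹, Φ s * (s ^ M)⁻¹, Complex.exp (Φ s * (s ^ M)⁻¹)] c ≠ 0 →
      (G.map (MvPolynomial.eval ![(s ^ k)⁻¹, Φ s * (s ^ M)⁻¹,
        Complex.exp (Φ s * (s ^ M)⁻¹)])).eval y = 0 →
      (Sum.elim ![(s ^ k)⁻¹, Φ s * (s ^ M)⁻¹] ![y, Complex.exp (Φ s * (s ^ M)⁻¹)] :
        Fin 2 ⊕ Fin 2 → ℂ) ∈ S) :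
    UnprojectedDense S := by
  classical
  obtain ⟨p, c₀, hc₀, hp0, hp, hF, hre, hnorm, hG⟩ := exists_expPoints_bottomEdge F hFirr
    hn hk hM hΦan hplace hz hdir G G₀ hG₀ h2
  have hpW : Tendsto p atTop (𝓝[≠] (0 : ℂ)) :=
    tendsto_nhdsWithin_iff.2 ⟨hp, Eventually.of_forall hp0⟩
  have hguard := eventually_guard_ne_zero F hFirr hn hk hM hΦan hplace F₃ hF₃ c hc hc₀
  obtain ⟨J₀, hJ₀⟩ := Filter.eventually_atTop.1 (hpW.eventually (hsub.and hguard))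
  -- the exponential points
  set P : ℕ → Fin 2 ⊕ Fin 2 → ℂ := fun m =>
    Sum.elim ![(p (J₀ + m) ^ k)⁻¹, Φ (p (J₀ + m)) * (p (J₀ + m) ^ M)⁻¹]
      ![Complex.exp ((p (J₀ + m) ^ k)⁻¹), Complex.exp (Φ (p (J₀ + m)) * (p (J₀ + m) ^ M)⁻¹)]
    with hPdef
  have hPS : ∀ m, P m ∈ S := fun m =>
    (hJ₀ (J₀ + m) (Nat.le_add_right _ _)).1 _ (Complex.exp_ne_zero _)
      ((hJ₀ (J₀ + m) (Nat.le_add_right _ _)).2 (hre (J₀ + m))) (hG (J₀ + m))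
  have hPΓ : ∀ m, P m ∈ expGraph ℂ 2 := by
    intro m
    rw [mem_expGraph_iff]
    intro i
    rw [Literature.ModelTheory.ExponentialFields.ExponentialRing.complex_exp_eq]
    fin_cases i <;> simp [hPdef]
  -- growth of `x₁`
  set Lg : ℕ → ℝ := fun m => c₀ * ‖p (J₀ + m)‖⁻¹ ^ M with hLg
  have hpJ : Tendsto (fun m => p (J₀ + m)) atTop (𝓝 0) :=
    hp.comp ((tendsto_add_atTop_nat J₀).congr fun m => Nat.add_comm m J₀)
  have hLgtop : Tendsto Lg atTop atTop := by
    have h1 : Tendsto (fun m => ‖p (J₀ + m)‖⁻¹) atTop atTop := by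
      have h2 : Tendsto (fun m => ‖p (J₀ + m)‖) atTop (𝓝[>] 0) :=
        tendsto_nhdsWithin_iff.2 ⟨by simpa using hpJ.norm,
          Eventually.of_forall fun m => norm_pos_iff.2 (hp0 _)⟩
      exact tendsto_inv_nhdsGT_zero.comp h2
    exact (tendsto_pow_atTop (by omega : M ≠ 0) |>.comp h1).const_mul_atTop hc₀
  have hgr : Tendsto (fun m => |(P m (Sum.inl 1)).re| / Real.log (2 + ‖P m (Sum.inl 1)‖))
      atTop atTop := by
    refine tendsto_abs_re_div_log_of_escape hLgtop (A := (‖Φ 0‖ + 1) / c₀) (fun m => ?_)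
      (fun m => ?_)
    · simp only [hPdef, Sum.elim_inl, Matrix.cons_val_one, Matrix.cons_val_zero, hLg]
      have := hre (J₀ + m)
      linarith
    · simp only [hPdef, Sum.elim_inl, Matrix.cons_val_one, Matrix.cons_val_zero, hLg]
      have := hnorm (J₀ + m)
      rw [show (‖Φ 0‖ + 1) / c₀ * (c₀ * ‖p (J₀ + m)‖⁻¹ ^ M) = (‖Φ 0‖ + 1) * ‖p (J₀ + m)‖⁻¹ ^ M by
        field_simp]
      exact this
  exact unprojectedDense_of_growth hS hdim 1 hPS hPΓ hgr

end DegenerateDirectionGuard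

end Summit.Schanuel.Schanuel.Theorems

end
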